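import Summits.AnomalousDissipation.AnomalousDissipation.Theses.TaylorCertificates
import Summits.AnomalousDissipation.AnomalousDissipation.Theorems.TaylorCertificatesTargetImpliesSteadyDirect
import Summits.AnomalousDissipation.AnomalousDissipation.Theorems.EnsembleCeiling.Negative.DiracAtoms
import Summits.AnomalousDissipation.AnomalousDissipation.Theorems.TaylorCertificatePair.Negative.Modes
import Literature.Analysis.FluidPDE.EulerReynolds
import Literature.Analysis.FluidPDE.TorusForceBookkeeping

/-!
# Negative knowledge for the crux `SteadyStatesLoudBounded` (stmt-AnomalousDissipation-13038):
# steady states above a level kill every ceiling at that level — the crux modulo `SteadyStatesAboveEverywhere`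

Line lead `prover-line-stmt-AnomalousDissipation-13038-c2-0` (2026-08-17), line `lamb-floor-f123-shared-ceiling`
(variant B). The kernel-checked KILL CRITERION of the crux's CEILING conjunct, in the vocabulary of the strategist's
`Cruxes/SteadyStatesLoudBounded/CensusSketchV3.lean` §N (`SteadyStatesAbove`, typed there; here landed):

* `SteadyStatesAbove f E` — `NS_ν(f)` has smooth admissible classical steady states of energy `> E` at arbitrarily
  small viscosity (fat, warm or `O(1)`: anything above the level).
* `not_steadyCeiling_of_statesAbove` — such states kill the steady ceiling `∫|u|² ≤ E` below every `ν₁ > 0`;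
* `not_ensembleCeiling_of_statesAbove` — and, through the Dirac masses at their `H`-representatives
  (`TargetImpliesSteadyDirect.exists_steadyState_of_classical`, `DiracAtoms.norm_sq_le_of_ceiling`), they kill the
  ENSEMBLE ceiling at level `E` over FMRT stationary statistical solutions — the exact shape of the live line's stub
  `stub_f123EnsembleCeiling2` (`f = f₁₂₃`, `E = 2`) and of the ceiling half of the route target `X`;
* `F123SteadyStatesAbove2`, `stub_f123EnsembleCeiling2_false_of_statesAbove2` — the instance at the line's force
  `f₁₂₃ = (sin 2πx₃, sin 4πx₁, sin 6πx₂)` and level `2`: the live stub S2′ (verbatim signature) is false modulo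
  `F123SteadyStatesAbove2` (verbatim `CensusSketchV3.F123SteadyStatesAbove2`; numerically TRUE: fat gravest-ray branch);
* `not_witness_of_statesAbove` — a force with steady states above every level is not a witness of the crux;
* `zero_not_witness` — the zero force is not a witness (`u = 0` is a quiet steady state: the FLOOR fails);
* `SteadyStatesAboveEverywhere` — HYPOTHESIS `H`: every nonzero admissible force has steady states above every level
  at arbitrarily small viscosity (the universal form of the gravest-line relaminarisation mechanism: exact at
  eigen/Beltrami/unidirectional/planar-compatible forces, Disproof §6–§9; numerical at `f_GP` (ABC ray, kit j015722)
  and at `f₁₂₃` (gravest ray, kit j018963/j020770 and this seat's eddy-resolved re-trace); research-grade as a theorem: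
  an implicit-function problem around a Kolmogorov shear of diverging Reynolds number, STRATEGY-CENSUS v3 §N10);
* `SteadyStatesLoudBounded_false_of_SteadyStatesAboveEverywhere : SteadyStatesAboveEverywhere → ¬ SteadyStatesLoudBounded`
  — the crux is false modulo `H` (negative-modulo lemma; `H` is what the tree cannot yet construct).

Nothing here asserts a Theses statement unconditionally.
-/

noncomputable section

-- `Summit.AnomalousDissipation.AnomalousDissipation.…` is the tree's mandated summit/problem namespace (single-conjunct summit).
set_option linter.dupNamespace false

open MeasureTheory
open scoped InnerProductSpace ENNReal

namespace Summit.AnomalousDissipation.AnomalousDissipation.Theorems.SteadyStatesLoudBounded.Negative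

open Literature.Analysis.FunctionSpaces Literature.Analysis.FunctionSpaces.Torus Literature.Analysis.FluidPDE
open Summit.AnomalousDissipation.AnomalousDissipation.Theses.TaylorCertificates
open Summit.AnomalousDissipation.AnomalousDissipation.Theorems.EnsembleCeiling.Negative

/-! ## Vocabulary (verbatim `CensusSketchV3.lean` §0/§N) -/

/-- The crux's steady weak form of `NS_ν(f)` at a smooth `u` (verbatim the hypothesis block of the route decl):
`∫ ⟪νΔu − (u·∇)u + f, w⟫ = 0` for every smooth divergence-free mean-zero `w`. -/
def IsCruxSteady (ν : ℝ) (f u : (UnitAddTorus (Fin 3) → EuclideanSpace ℝ (Fin 3))) : Prop :=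
  ∀ w : (UnitAddTorus (Fin 3) → EuclideanSpace ℝ (Fin 3)), IsSmooth w → IsDivFree w → HasZeroMean w →
    ∫ x, inner ℝ (ν • laplacian u x - convect u u x + f x) (w x) = 0

/-- **`f` has steady states above the level `E` at arbitrarily small viscosity**: for every `ν₀ > 0` some
`ν ∈ (0, ν₀)` carries a smooth divergence-free mean-zero classical steady state `u` of `NS_ν(f)` with `E < ∫|u|²`
(verbatim `CensusSketchV3.SteadyStatesAbove`). -/
def SteadyStatesAbove (f : (UnitAddTorus (Fin 3) → EuclideanSpace ℝ (Fin 3))) (E : ℝ) : Prop :=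
  ∀ ν₀ : ℝ, 0 < ν₀ → ∃ ν : ℝ, 0 < ν ∧ ν < ν₀ ∧ ∃ u : (UnitAddTorus (Fin 3) → EuclideanSpace ℝ (Fin 3)), IsSmooth u ∧ IsDivFree u ∧
    HasZeroMean u ∧ IsCruxSteady ν f u ∧ E < ∫ x, ‖u x‖ ^ 2

/-- **HYPOTHESIS `H` — steady states above every level, at every nonzero admissible force.** The universal form of
the gravest-line relaminarisation mechanism (fat branches `u = tV_ℓ/ν + O(1)`); open. -/
def SteadyStatesAboveEverywhere : Prop :=
  ∀ f : (UnitAddTorus (Fin 3) → EuclideanSpace ℝ (Fin 3)), IsSmooth f → IsDivFree f → HasZeroMean f → (∃ x, f x ≠ 0) → ∀ E : ℝ, SteadyStatesAbove f E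

/-! ## States above the level kill the steady and the ensemble ceiling -/

/-- **States above the level kill the steady ceiling at that level**: no `ν₁ > 0` bounds the energy of all smooth
admissible steady states of `NS_ν(f)`, `ν ∈ (0, ν₁)`, by `E`. -/
theorem not_steadyCeiling_of_statesAbove {f : (UnitAddTorus (Fin 3) → EuclideanSpace ℝ (Fin 3))} {E : ℝ} (h : SteadyStatesAbove f E) :
    ¬ ∃ ν₁ : ℝ, 0 < ν₁ ∧ ∀ ν : ℝ, 0 < ν → ν < ν₁ → ∀ u : (UnitAddTorus (Fin 3) → EuclideanSpace ℝ (Fin 3)), IsSmooth u → IsDivFree u → HasZeroMean u →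
      IsCruxSteady ν f u → ∫ x, ‖u x‖ ^ 2 ≤ E := by
  rintro ⟨ν₁, hν₁, hC⟩
  obtain ⟨ν, hν, hνlt, u, hus, hud, huz, hst, hE⟩ := h ν₁ hν₁
  have := hC ν hν hνlt u hus hud huz hst
  linarith

/-- **States above the level kill the ENSEMBLE ceiling at that level** (the shape of `stub_f123EnsembleCeiling2` and of
the ceiling half of `X`): the Dirac mass at the `H`-representative `U ∈ V` of a classical steady state `u` is a
stationary statistical solution with integrable energy and `ensembleEnergy δ_U = ‖U‖² = ∫|u|² > E`. -/
theorem not_ensembleCeiling_of_statesAbove {f : (UnitAddTorus (Fin 3) → EuclideanSpace ℝ (Fin 3))} (hf : IsSmooth f) {E : ℝ} (h : SteadyStatesAbove f E) :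
    ¬ ∃ ν₀ : ℝ, 0 < ν₀ ∧ ∀ ν : ℝ, 0 < ν → ν < ν₀ →
      ∀ μ : Measure (Torus.energySpace (Fin 3)), Torus.IsStationaryStatisticalSolution ν f μ →
        Integrable (fun v : Torus.energySpace (Fin 3) => ‖v‖ ^ 2) μ → Torus.ensembleEnergy μ ≤ E := by
  rintro ⟨ν₀, hν₀, hC⟩
  obtain ⟨ν, hν, hνlt, u, hus, hud, huz, hst, hE⟩ := h ν₀ hν₀
  obtain ⟨U, hU, hV, hUsteady⟩ := TargetImpliesSteadyDirect.exists_steadyState_of_classical hf hus hud huz hst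
  have hbdd : ‖U‖ ^ 2 ≤ E := norm_sq_le_of_ceiling hν (hf.memLp 2) (hC ν hν hνlt) hV hUsteady
  rw [TargetImpliesSteadyDirect.norm_sq_eq_integral_of_ae_rep hU] at hbdd
  linarith

/-! ## The instance at the line's force `f₁₂₃` and level `2` (stub S2′ of `lamb-floor-f123-shared-ceiling`, variant B) -/

/-- Frequencies `e₃, 2e₁, 3e₂` of the detuned cyclic force (verbatim the live skeleton's `K₁₂₃`). -/
local notation "K₁₂₃" => (![![0, 0, 1], ![2, 0, 0], ![0, 3, 0]] : Fin 3 → (Fin 3 → ℤ))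
/-- Amplitudes `-i e₁, -i e₂, -i e₃` (verbatim the live skeleton's `Z₁₂₃`). -/
local notation "Z₁₂₃" => (![(WithLp.toLp 2 ![-Complex.I, 0, 0] : EuclideanSpace ℂ (Fin 3)),
  (WithLp.toLp 2 ![0, -Complex.I, 0] : EuclideanSpace ℂ (Fin 3)),
  (WithLp.toLp 2 ![0, 0, -Complex.I] : EuclideanSpace ℂ (Fin 3))] : Fin 3 → EuclideanSpace ℂ (Fin 3))
/-- `f₁₂₃ = (sin 2πx₃, sin 4πx₁, sin 6πx₂)` as the tree's mode sum (verbatim the live skeleton's `f₁₂₃`). -/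
local notation "f₁₂₃" => (∑ mm, Torus.realTrigPoly {K₁₂₃ mm} (fun _ => Z₁₂₃ mm))

/-- Steady states of `NS_ν(f₁₂₃)` above energy `2` at arbitrarily small `ν` (verbatim `CensusSketchV3.F123SteadyStatesAbove2`).
Numerically TRUE: the fat gravest-ray branch `u_ν ≈ t sin(2πx₃)e₁/(4π²ν) + O(1)`, `∫|u_ν|² = 9.6 → 84` for
`ν = 0.005 → 0.0019` (kit j018963, j020770; this seat's eddy-resolved re-trace). Open as a theorem (implicit-function problem
around a Kolmogorov shear of diverging Reynolds number). -/
def F123SteadyStatesAbove2 : Prop := SteadyStatesAbove f₁₂₃ 2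

/-- **The live ceiling stub S2′ `stub_f123EnsembleCeiling2` (signature verbatim) is FALSE modulo `F123SteadyStatesAbove2`.** -/
theorem stub_f123EnsembleCeiling2_false_of_statesAbove2 (h : F123SteadyStatesAbove2) :
    ¬ ∃ ν₀ : ℝ, 0 < ν₀ ∧ ∀ ν : ℝ, 0 < ν → ν < ν₀ →
      ∀ μ : Measure (Torus.energySpace (Fin 3)), Torus.IsStationaryStatisticalSolution ν f₁₂₃ μ →
        Integrable (fun v : Torus.energySpace (Fin 3) => ‖v‖ ^ 2) μ → Torus.ensembleEnergy μ ≤ 2 :=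
  not_ensembleCeiling_of_statesAbove
    (Summit.AnomalousDissipation.AnomalousDissipation.Theorems.TaylorCertificatePair.Negative.isSmooth_modes _ _) h

/-! ## Consequences for the crux -/

/-- **A force with steady states above every level is not a witness of the crux** (its CEILING conjunct fails at
every `E`). -/
theorem not_witness_of_statesAbove {f : (UnitAddTorus (Fin 3) → EuclideanSpace ℝ (Fin 3))} (h : ∀ E : ℝ, SteadyStatesAbove f E) :
    ¬ ∃ (ε₀ E ν₀ : ℝ), 0 < ε₀ ∧ 0 < ν₀ ∧ ∀ ν : ℝ, 0 < ν → ν < ν₀ → ∀ u : (UnitAddTorus (Fin 3) → EuclideanSpace ℝ (Fin 3)), IsSmooth u → IsDivFree u →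
      HasZeroMean u → IsCruxSteady ν f u → ε₀ ≤ ν * gradNormSq u ∧ ∫ x, ‖u x‖ ^ 2 ≤ E := by
  rintro ⟨ε₀, E, ν₀, -, hν₀, hB⟩
  exact not_steadyCeiling_of_statesAbove (h E)
    ⟨ν₀, hν₀, fun ν hν hνlt u hus hud huz hst => (hB ν hν hνlt u hus hud huz hst).2⟩

/-- The zero field has zero mean. -/
theorem hasZeroMean_zero_field : HasZeroMean (fun _ : UnitAddTorus (Fin 3) => (0 : EuclideanSpace ℝ (Fin 3))) := by
  simp [HasZeroMean]

/-- `‖∇0‖² = 0` (partial derivatives of a constant vanish). -/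
theorem gradNormSq_zero_field : gradNormSq (fun _ : UnitAddTorus (Fin 3) => (0 : EuclideanSpace ℝ (Fin 3))) = 0 := by
  have h : ∀ (i : Fin 3) (x : UnitAddTorus (Fin 3)),
      partialDeriv i (fun _ : UnitAddTorus (Fin 3) => (0 : EuclideanSpace ℝ (Fin 3))) x = 0 := fun i x => by
    simp [Torus.partialDeriv, Torus.lineDeriv]
  simp [gradNormSq, h]

/-- `u = 0` is a classical steady state of the UNFORCED system at every viscosity. -/
theorem isCruxSteady_zero (ν : ℝ) :
    IsCruxSteady ν (fun _ => 0) (fun _ : UnitAddTorus (Fin 3) => (0 : EuclideanSpace ℝ (Fin 3))) := by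
  intro w _ _ _
  simp

/-- **The zero force is not a witness of the crux**: `u = 0` is a smooth admissible steady state of `NS_ν(0)` with
`ν‖∇u‖² = 0 < ε₀` (the FLOOR conjunct fails; cf. Disproof `not_body_zero`). -/
theorem zero_not_witness :
    ¬ ∃ (ε₀ E ν₀ : ℝ), 0 < ε₀ ∧ 0 < ν₀ ∧ ∀ ν : ℝ, 0 < ν → ν < ν₀ → ∀ u : (UnitAddTorus (Fin 3) → EuclideanSpace ℝ (Fin 3)), IsSmooth u → IsDivFree u →
      HasZeroMean u → IsCruxSteady ν (fun _ => 0) u → ε₀ ≤ ν * gradNormSq u ∧ ∫ x, ‖u x‖ ^ 2 ≤ E := by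
  rintro ⟨ε₀, E, ν₀, hε₀, hν₀, hB⟩
  have h1 := (hB (ν₀ / 2) (by positivity) (by linarith) (fun _ => 0) (isSmooth_const _)
    (fun x => Torus.divergence_zero x) hasZeroMean_zero_field (isCruxSteady_zero _)).1
  rw [gradNormSq_zero_field, mul_zero] at h1
  linarith

/-- **THE CRUX IS FALSE MODULO `SteadyStatesAboveEverywhere`** (negative-modulo lemma). A witness force `f` of
`SteadyStatesLoudBounded` is either identically zero — then `u = 0` is a quiet steady state and the FLOOR fails
(`zero_not_witness`) — or nonzero somewhere — then `H` supplies, at arbitrarily small viscosity, steady states above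
the witness's energy level `E`, and the CEILING fails (`not_witness_of_statesAbove`). -/
theorem SteadyStatesLoudBounded_false_of_SteadyStatesAboveEverywhere :
    SteadyStatesAboveEverywhere → ¬ SteadyStatesLoudBounded := by
  intro hH hcrux
  obtain ⟨f, hfs, hfd, hfz, hbody⟩ := hcrux
  by_cases hf0 : ∃ x, f x ≠ 0
  · exact not_witness_of_statesAbove (hH f hfs hfd hfz hf0) hbody
  · push Not at hf0
    have hf : f = fun _ => 0 := funext hf0
    subst hf
    exact zero_not_witness hbody

end Summit.AnomalousDissipation.AnomalousDissipation.Theorems.SteadyStatesLoudBounded.Negative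

end
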